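import Summits.BirchSwinnertonDyer.BirchSwinnertonDyer.Theses.TameQuarticManinParity
import Summits.BirchSwinnertonDyer.BirchSwinnertonDyer.Theorems.ManinLocalTwoThreeCDivisionOddSquarefreeResidual
import Summits.BirchSwinnertonDyer.Rank1Residual.Additive.KatoDescentRankOneCountContraOfFacts
import HarnessLib

/-!
# Route `TameQuarticManinParity`: every Manin-unit item at `p = 3` on the class (t′) — 23736, 23737, 24498, 24499, 24627,
# 24628, 24070, 24046, 27753 — and the rung W-ALL/add.t′.r1, MODULO THE PRINTED CALEGARI–DIMITROV–TANG UNBOUNDED-DENOMINATORS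
# THEOREM ONLY — `--supports`

Cell `pub/bsd-wall`, seat `bsd-line-ttd-p1` (prover 1/2 on the sibling line TeichmullerTwistDescent, g31; cross-route helper for the
route pen bsd-idea-3, announced on STATUS 2026-08-30T11:2xZ). THEOREMS ONLY (no definition, no named fact, no `sorry`); every theorem
is `proof.conditional` on ONE cite-only PRINTED fact, the vendored unbounded-denominators theorem
`Literature.NumberTheory.Automorphic.CalegariDimitrovTang2025_unboundedDenominators_algInt` («CDT»; Calegari–Dimitrov–Tang, J. Amer.
Math. Soc. 38 (2025), Thm. 1, Remarks 58–59); nothing is closed by name; BSD is not proved; Manin's conjecture is not proved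
unconditionally; no Manin theorem is announced (director-bsd (505)/(527): «closed modulo CDT; items open»).

WHAT THIS FILE DOES. The cell bsd-f2-manin's `ManinLocalTwoThree.CDivisionUDC.abs_maninConstant_eq_one_of_CDT_of_odd_sq_dvd`
(p755101: `|c(D)| = 1` for every LATTICE-OPTIMAL datum `D` of a globally minimal curve at a level `N` with an odd `p² ∣ N`, `3 ≤ p`,
modulo CDT) covers `p = 3`: at an ADDITIVE `3` the conductor exponent is `≥ 2`, so `9 ∣ N(W)`
(`ContraCount.sq_dvd_conductorNorm_of_addv`, any prime). Hence (§1) `not_dvd_maninConstant_of_CDT_of_addv`: `p ∤ c(D)` at every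
lattice-optimal CONDUCTOR-LEVEL datum of every globally minimal curve additive at ANY odd prime `p` (so also `p = 3`; the TTD
sibling `TeichmullerTwistDescent.not_dvd_c_of_CDT`, p769544, is the `p ≥ 5`, any-level form); (§2) the route's nine Manin-unit
declarations at `3` on (t′) BY NAME, each `⟸ CDT` alone with all their other clauses (non-CM, `SubTprime`, (ir)reducibility of
`E[3]`, degree-minimality, `3 ∣ deg` / `3 ∤ deg`, `ord₃ Δ ∈ {3, 9}`) idle; (§3) the rung `WAllExclAddTprimeAtThreeRankOne` ⟸ CDT ∧
`PublishedInputGZK` (19921) ∧ the two XL halves `TprimeHeegnerUpperOfManinUnit` (23738), `TprimeRankOneLowerAtThree` (23739), via the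
route's `closes`.

HONEST STATUS: CONDITIONAL on the printed CDT fact (the cell bsd-f2-manin's trust base; audits (505)/(527) pending); the items stay
OPEN by name; the route's live residual is {23738, 23739} ∪ print. BSD is not proved by this; no W-ALL class theorem is proved by
this; Manin's conjecture is not proved by this. [cite: CalegariDimitrovTang2025, Thm. 1 and Remarks 58–59]
[cite: LingOesterle1991, Thm. 6] [cite: Silverman1994, IV.10.2(c) (conductor exponent ≥ 2 at an additive place)]
[cite: GrossZagier1986, I (7.3)] [cite: Kolyvagin1990, Thm. A]
-/

set_option autoImplicit false
-- single-conjunct summit: `Summit.BirchSwinnertonDyer.BirchSwinnertonDyer.…` repeats the name by design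
set_option linter.dupNamespace false

noncomputable section

open scoped Classical

open WeierstrassCurve Literature.NumberTheory.EllipticCurves Literature.NumberTheory.EllipticCurves.ModularForms
  Literature.NumberTheory.EllipticCurves.Rank1Residual
  Summit.BirchSwinnertonDyer.Rank1Residual
  Summit.BirchSwinnertonDyer.BirchSwinnertonDyer.Theses.TameQuarticManinParity
  Summit.BirchSwinnertonDyer.BirchSwinnertonDyer.Theorems

namespace Summit.BirchSwinnertonDyer.BirchSwinnertonDyer.Theorems.TameQuarticManinParityOfCDT

/-! ### §1 Manin's `p`-part at a conductor-level lattice-optimal datum, any odd additive `p`, modulo CDT -/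

/-- **`p ∤ c(D)` at every lattice-optimal conductor-level datum of every globally minimal curve additive at an odd prime `p`
(in particular `p = 3`), MODULO CDT.** `p² ∣ N(W)` at an additive place (any prime), then the cell bsd-f2-manin's
`CDivisionUDC.abs_maninConstant_eq_one_of_CDT_of_odd_sq_dvd`. CONDITIONAL on `hCDT`; Manin's conjecture and BSD are not proved
by this. [cite: CalegariDimitrovTang2025, Thm. 1 and Remarks 58–59] [cite: Silverman1994, IV.10.2(c)] -/
theorem not_dvd_maninConstant_of_CDT_of_addv
    (hCDT : Literature.NumberTheory.Automorphic.CalegariDimitrovTang2025_unboundedDenominators_algInt)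
    {W : WeierstrassCurve ℚ} [W.IsElliptic] [W.IsGloballyMinimal] [NeZero (W.conductorNorm ℤ)]
    (D : ModularParametrizationData W (W.conductorNorm ℤ)) {p : ℕ} [Fact p.Prime] (hp3 : 3 ≤ p) (hadd : Addv W p)
    (hlat : ∀ z ∈ D.L.lattice, ∃ w ∈ periodLattice D.f, z = D.c * w) : ¬ (p : ℤ) ∣ D.maninConstant := by
  have hp : p.Prime := Fact.out
  have h1 : |D.maninConstant| = 1 :=
    ManinLocalTwoThree.CDivisionUDC.abs_maninConstant_eq_one_of_CDT_of_odd_sq_dvd hCDT D hlat hp hp3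
      (Additive.ContraCount.sq_dvd_conductorNorm_of_addv W p hadd)
  intro hpc
  have hdvd : (p : ℤ) ∣ |D.maninConstant| := (dvd_abs (p : ℤ) D.maninConstant).mpr hpc
  rw [h1] at hdvd
  have hp1 : p ∣ 1 := by exact_mod_cast hdvd
  exact hp.ne_one (Nat.dvd_one.mp hp1)

/-! ### §2 The route's Manin-unit items at `3`, BY NAME, modulo CDT -/

/-- **Crux 2 `TprimeIrreducibleManinUnit` (stmt-BirchSwinnertonDyer-23736) ⟸ CDT** (non-CM, `SubTprime`, `E[3]` irreducible,
degree-minimality idle). CONDITIONAL; the item is not closed by this; BSD is not proved by this. [cite: CalegariDimitrovTang2025, Thm. 1 and Remarks 58–59] -/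
theorem tprimeIrreducibleManinUnit_of_CDT
    (hCDT : Literature.NumberTheory.Automorphic.CalegariDimitrovTang2025_unboundedDenominators_algInt) :
    TprimeIrreducibleManinUnit := by
  intro W _ _ _ _hCM hadd _hsub _hirr D hlat _hmin
  exact not_dvd_maninConstant_of_CDT_of_addv hCDT D le_rfl hadd hlat

/-- **Crux 3 `TprimeReducibleManinUnit` (stmt-BirchSwinnertonDyer-23737) ⟸ CDT** (the reducible rows; clauses idle). CONDITIONAL;
the item is not closed by this; BSD is not proved by this. [cite: CalegariDimitrovTang2025, Thm. 1 and Remarks 58–59] -/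
theorem tprimeReducibleManinUnit_of_CDT
    (hCDT : Literature.NumberTheory.Automorphic.CalegariDimitrovTang2025_unboundedDenominators_algInt) :
    TprimeReducibleManinUnit := by
  intro W _ _ _ _hCM hadd _hsub _hred D hlat _hmin
  exact not_dvd_maninConstant_of_CDT_of_addv hCDT D le_rfl hadd hlat

/-- **`TprimeIrrManinUnitOfThreeDvdDegree` (stmt-BirchSwinnertonDyer-24498, the `3 ∣ deg` child of crux 2) ⟸ CDT.** CONDITIONAL;
the item is not closed by this; BSD is not proved by this. [cite: CalegariDimitrovTang2025, Thm. 1 and Remarks 58–59] -/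
theorem tprimeIrrManinUnitOfThreeDvdDegree_of_CDT
    (hCDT : Literature.NumberTheory.Automorphic.CalegariDimitrovTang2025_unboundedDenominators_algInt) :
    TprimeIrrManinUnitOfThreeDvdDegree := by
  intro W _ _ _ _hCM hadd _hsub _hirr D hlat _hmin _hdeg
  exact not_dvd_maninConstant_of_CDT_of_addv hCDT D le_rfl hadd hlat

/-- **`TprimeIrrManinUnitOfDegreePrimeToThree` (stmt-BirchSwinnertonDyer-24499, the `3 ∤ deg` child of crux 2; closable granted
ČNS, here without ČNS) ⟸ CDT.** CONDITIONAL; the item is not closed by this; BSD is not proved by this.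
[cite: CalegariDimitrovTang2025, Thm. 1 and Remarks 58–59] -/
theorem tprimeIrrManinUnitOfDegreePrimeToThree_of_CDT
    (hCDT : Literature.NumberTheory.Automorphic.CalegariDimitrovTang2025_unboundedDenominators_algInt) :
    TprimeIrrManinUnitOfDegreePrimeToThree := by
  intro W _ _ _ _hCM hadd _hsub _hirr D hlat _hmin _hdeg
  exact not_dvd_maninConstant_of_CDT_of_addv hCDT D le_rfl hadd hlat

/-- **`TprimeRedManinUnitOfThreeDvdDegree` (stmt-BirchSwinnertonDyer-24627, the `3 ∣ deg` child of crux 3) ⟸ CDT.** CONDITIONAL;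
the item is not closed by this; BSD is not proved by this. [cite: CalegariDimitrovTang2025, Thm. 1 and Remarks 58–59] -/
theorem tprimeRedManinUnitOfThreeDvdDegree_of_CDT
    (hCDT : Literature.NumberTheory.Automorphic.CalegariDimitrovTang2025_unboundedDenominators_algInt) :
    TprimeRedManinUnitOfThreeDvdDegree := by
  intro W _ _ _ _hCM hadd _hsub _hred D hlat _hmin _hdeg
  exact not_dvd_maninConstant_of_CDT_of_addv hCDT D le_rfl hadd hlat

/-- **`TprimeRedManinUnitOfDegreePrimeToThree` (stmt-BirchSwinnertonDyer-24628, the `3 ∤ deg` child of crux 3; closable granted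
ČNS, here without ČNS) ⟸ CDT.** CONDITIONAL; the item is not closed by this; BSD is not proved by this.
[cite: CalegariDimitrovTang2025, Thm. 1 and Remarks 58–59] -/
theorem tprimeRedManinUnitOfDegreePrimeToThree_of_CDT
    (hCDT : Literature.NumberTheory.Automorphic.CalegariDimitrovTang2025_unboundedDenominators_algInt) :
    TprimeRedManinUnitOfDegreePrimeToThree := by
  intro W _ _ _ _hCM hadd _hsub _hred D hlat _hmin _hdeg
  exact not_dvd_maninConstant_of_CDT_of_addv hCDT D le_rfl hadd hlat

/-- **`TprimeTameThreeOptimalManinUnit` (stmt-BirchSwinnertonDyer-24070: Kodaira III at `3`, `ord₃ Δ = 3`, `3 ∣ deg`) ⟸ CDT.**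
CONDITIONAL; the item is not closed by this; BSD is not proved by this. [cite: CalegariDimitrovTang2025, Thm. 1 and Remarks 58–59] -/
theorem tprimeTameThreeOptimalManinUnit_of_CDT
    (hCDT : Literature.NumberTheory.Automorphic.CalegariDimitrovTang2025_unboundedDenominators_algInt) :
    TprimeTameThreeOptimalManinUnit := by
  intro W _ _ _ hadd _hsub _hv D hlat _hmin _hdeg
  exact not_dvd_maninConstant_of_CDT_of_addv hCDT D le_rfl hadd hlat

/-- **`TprimeTameStarredOptimalManinUnit` (stmt-BirchSwinnertonDyer-24046: the starred partner III*, `ord₃ Δ = 9`) ⟸ CDT.**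
CONDITIONAL; the item is not closed by this; BSD is not proved by this. [cite: CalegariDimitrovTang2025, Thm. 1 and Remarks 58–59] -/
theorem tprimeTameStarredOptimalManinUnit_of_CDT
    (hCDT : Literature.NumberTheory.Automorphic.CalegariDimitrovTang2025_unboundedDenominators_algInt) :
    TprimeTameStarredOptimalManinUnit := by
  intro W _ _ _ hadd _hsub _hv D hlat _hmin
  exact not_dvd_maninConstant_of_CDT_of_addv hCDT D le_rfl hadd hlat

/-- **`TprimeRedKodairaThreeManinUnitOfThreeDvdDegree` (stmt-BirchSwinnertonDyer-27753: reducible, `ord₃ Δ = 3`, `3 ∣ deg`) ⟸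
CDT.** CONDITIONAL; the item is not closed by this; BSD is not proved by this. [cite: CalegariDimitrovTang2025, Thm. 1 and Remarks 58–59] -/
theorem tprimeRedKodairaThreeManinUnitOfThreeDvdDegree_of_CDT
    (hCDT : Literature.NumberTheory.Automorphic.CalegariDimitrovTang2025_unboundedDenominators_algInt) :
    TprimeRedKodairaThreeManinUnitOfThreeDvdDegree := by
  intro W _ _ _ _hCM hadd _hsub _hred D hlat _hmin _hv _hdeg
  exact not_dvd_maninConstant_of_CDT_of_addv hCDT D le_rfl hadd hlat

/-! ### §3 The rung W-ALL/add.t′.r1 modulo CDT, GZK and the two XL halves -/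

/-- **The rung `WAllExclAddTprimeAtThreeRankOne` ⟸ CDT ∧ `PublishedInputGZK` (19921) ∧ `TprimeHeegnerUpperOfManinUnit` (23738) ∧
`TprimeRankOneLowerAtThree` (23739)** — through the route's `closes` with cruxes 2 and 3 from §2. The Manin cruxes 23736 / 23737
are NOT hypotheses. CONDITIONAL; no item is closed by this; BSD is not proved and no W-ALL class theorem is proved by this.
[cite: CalegariDimitrovTang2025, Thm. 1 and Remarks 58–59] [cite: GrossZagier1986, I (7.3)] [cite: Kolyvagin1990, Thm. A] -/
theorem wAllExclAddTprimeAtThreeRankOne_of_CDT_of_halves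
    (hCDT : Literature.NumberTheory.Automorphic.CalegariDimitrovTang2025_unboundedDenominators_algInt)
    (hP : PublishedInputGZK) (h₄ : TprimeHeegnerUpperOfManinUnit) (h₅ : TprimeRankOneLowerAtThree) :
    Summit.BirchSwinnertonDyer.WAllExclAddTprimeAtThreeRankOne :=
  closes hP (tprimeIrreducibleManinUnit_of_CDT hCDT) (tprimeReducibleManinUnit_of_CDT hCDT) h₄ h₅

end Summit.BirchSwinnertonDyer.BirchSwinnertonDyer.Theorems.TameQuarticManinParityOfCDT

end
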